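import Literature.Analysis.FluidPDE.TypeIAncientMild
import Literature.Analysis.FluidPDE.SelfSimilarLiouville
import HarnessLib

/-!
# Route `LerayQuarterDissipation`, crux `FiniteDissipationLiouville` (stmt-NavierStokesRegularity-22144),
  line `birth` — `stub_dssExclusion` reduces to the catalogued wall `TypeIDSSLiouville` plus an
  envelope bridge

`--supports stmt-NavierStokesRegularity-22144` (helper). The registered stub `stub_dssExclusion`
(backward `λ`-DSS exclusion in the finite-dissipation stratum, all `λ > 1`) is, by the crux
disprover's `Negative.dssExclusion_iff_dssLiouville`, a Liouville statement. This file pins its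
open content to the tree's catalogued open problem BY NAME: the Type-I `λ`-DSS Liouville wall
`Literature.Analysis.FluidPDE.TypeIDSSLiouville c` (Bradshaw–Tsai 2017, Open Problem 5.1; Tsai,
GSM 192, Conj. 8.8–8.9; known only for `λ` near `1`, Chae–Wolf 2017 Thm 1.3 / Pineau–Vicol 2026
Thm 1.6), whose hypothesis is the SPACE-TIME Type-I envelope `‖u(t,x)‖ ≤ C₀/(‖x‖ + √(−t))`:

* `dssExclusion_of_typeIDSSLiouville_of_envelope` — the wall for the factor `c` kills every
  `c`-DSS Type-I ancient mild field (KNSS gauge) that obeys some space-time envelope: the class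
  embeds in the wall's duality-form ancient mild class (`IsTypeIAncientMild.isAncientMildSolution`),
  slices are continuous hence measurable, and an a.e.-vanishing continuous slice vanishes.
* `dssExclusion_of_typeIDSSLiouville` — hence `stub_dssExclusion` (verbatim) follows from
  (i) the wall for all `c > 1` and (ii) the ENVELOPE BRIDGE "DSS members of the stratum obey a
  space-time Type-I envelope" (stated inline as a hypothesis; it is Chae–Wolf 2017 Thm 1.1 with
  `p = 6` — tree `chaeWolf2017_dss_typeI_decay_of_lt_nine` — once the slices are in `L⁶`, tree
  `memLp_six_slice`, and continuous in time in `L⁶`, the one step not yet formalised).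

So the open part of the stub is exactly the wall; the dissipation law enters only through the
bridge. Nothing here bears on Navier–Stokes regularity; no summit is proved.
-/

noncomputable section

open Set MeasureTheory Filter Topology Function Metric
open Literature.Analysis Literature.Analysis.FluidPDE
open scoped ENNReal NNReal

namespace Summit.NavierStokesRegularity.NavierStokesRegularity.Theorems.FiniteDissipationLiouville.Birth

-- the problem-side namespace duplicates `NavierStokesRegularity` by design (summit = problem)
set_option linter.dupNamespace false

/-- **The wall kills DSS Type-I ancient mild fields with an envelope.** If the Type-I `c`-DSS
Liouville statement `TypeIDSSLiouville c` holds, then every `c`-discretely self-similar Type-I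
ancient mild field in the KNSS gauge obeying a space-time Type-I envelope vanishes on `t < 0`. -/
theorem eq_zero_of_typeIDSSLiouville_of_envelope {c : ℝ} (hwall : TypeIDSSLiouville c) (hc : 1 < c)
    {C C₀ : ℝ} {w : ℝ → EuclideanSpace ℝ (Fin 3) → EuclideanSpace ℝ (Fin 3)}
    (hw : IsTypeIAncientMild C w) (henv : HasTypeIDecay C₀ w) (hdss : IsDiscretelySelfSimilar c w) :
    ∀ t < 0, ∀ x, w t x = 0 := by
  intro t ht
  have hae : w t =ᵐ[volume] 0 :=
    hwall hc w hw.isAncientMildSolution (fun s hs => hw.aestronglyMeasurable_slice hs) hdss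
      ⟨C₀, henv⟩ t ht
  have heq : w t = 0 :=
    ((hw.continuous_slice ht).ae_eq_iff_eq volume continuous_const).1 hae
  exact fun x => congrFun heq x

/-- **`stub_dssExclusion` under an envelope, from the wall** (regularity form). -/
theorem dssExclusion_of_typeIDSSLiouville_of_envelope
    (hwall : ∀ c : ℝ, 1 < c → TypeIDSSLiouville c) :
    ∀ (C K c C₀ : ℝ) (w : ℝ → EuclideanSpace ℝ (Fin 3) → EuclideanSpace ℝ (Fin 3)), 1 < c →
      IsTypeIAncientMild C w →
      (∀ s : ℝ, s < 0 → ∫⁻ x, ‖fderiv ℝ (w s) x‖ₑ ^ 2 ≤ ENNReal.ofReal (K / Real.sqrt (-s))) →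
      HasTypeIDecay C₀ w → IsDiscretelySelfSimilar c w →
      ¬ (∀ r > 0, ∀ M : ℝ, ∃ t ∈ Set.Ioo (-(r ^ 2)) (0 : ℝ),
          ∃ x ∈ Metric.ball (0 : EuclideanSpace ℝ (Fin 3)) r, M < ‖w t x‖) := by
  intro C K c C₀ w hc hw _ henv hdss hsing
  have hz := eq_zero_of_typeIDSSLiouville_of_envelope (hwall c hc) hc hw henv hdss
  obtain ⟨t, ht, x, -, hM⟩ := hsing 1 one_pos 0
  rw [hz t ht.2 x, norm_zero] at hM
  exact lt_irrefl 0 hM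

/-- **Reduction of `stub_dssExclusion` to the wall plus the envelope bridge.** If
`TypeIDSSLiouville c` holds for every `c > 1` (the catalogued open problem) and DSS members of
the finite-dissipation stratum obey a space-time Type-I envelope (the bridge, Chae–Wolf 2017
Thm 1.1-type), then the registered stub `stub_dssExclusion` holds verbatim. -/
theorem dssExclusion_of_typeIDSSLiouville
    (hwall : ∀ c : ℝ, 1 < c → TypeIDSSLiouville c)
    (hbridge : ∀ (C K c : ℝ) (w : ℝ → EuclideanSpace ℝ (Fin 3) → EuclideanSpace ℝ (Fin 3)),
      1 < c → IsTypeIAncientMild C w →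
      (∀ s : ℝ, s < 0 → ∫⁻ x, ‖fderiv ℝ (w s) x‖ₑ ^ 2 ≤ ENNReal.ofReal (K / Real.sqrt (-s))) →
      IsDiscretelySelfSimilar c w → ∃ C₀ : ℝ, HasTypeIDecay C₀ w) :
    ∀ (C K c : ℝ) (w : ℝ → EuclideanSpace ℝ (Fin 3) → EuclideanSpace ℝ (Fin 3)), 1 < c →
      IsTypeIAncientMild C w →
      (∀ s : ℝ, s < 0 → ∫⁻ x, ‖fderiv ℝ (w s) x‖ₑ ^ 2 ≤ ENNReal.ofReal (K / Real.sqrt (-s))) →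
      IsDiscretelySelfSimilar c w →
      ¬ (∀ r > 0, ∀ M : ℝ, ∃ t ∈ Set.Ioo (-(r ^ 2)) (0 : ℝ),
          ∃ x ∈ Metric.ball (0 : EuclideanSpace ℝ (Fin 3)) r, M < ‖w t x‖) := by
  intro C K c w hc hw hD hdss
  obtain ⟨C₀, henv⟩ := hbridge C K c w hc hw hD hdss
  exact dssExclusion_of_typeIDSSLiouville_of_envelope hwall C K c C₀ w hc hw hD henv hdss

end Summit.NavierStokesRegularity.NavierStokesRegularity.Theorems.FiniteDissipationLiouville.Birth

end
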